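import Mathlib
import Summits.NavierStokesRegularity.NavierStokesRegularity.Theorems.WakeRatchetTailRatchetPostFiringClock
import HarnessLib

/-!
# `WakeRatchet.TailRatchet` (stmt-NavierStokesRegularity-21808), door D4′ — QUENCHING and SUSTAINING a shell by
# its neighbours: the drain as extra damping (two-sided equilibration towards the K41 balance `Λu²/(1 + z/Λ)`)

Def-free comparison lemmas for one row `v' = −v + Λu² − Λ⁻¹vz` of the renormalised dyadic lattice (MODEL lattice
ODEs: the scalar dyadic member of Tao 2016 §1.2 / §4 in the self-similar variables of §6.4; nothing here concerns
the Navier–Stokes equations; stmt-21808 is neither proved nor refuted here and no stub of skeleton d00b85951d7c is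
closed).

Every comparison lemma of the door so far DROPS the drain `−Λ⁻¹vz ≤ 0` («the drain only helps»:
`WakeRatchetFiringClock.exp_mul_le_of_feed_sq_le`, `WakeRatchetDyadicPostFiring.exp_mul_le_of_feed_decay`).  The
estimate that remains on the door — the post-firing bound (D) / quiet times (QT), i.e. that the WAKE behind the
front is frozen at the Kolmogorov balance `Λ² W_{n−1}² ≈ W_n W_{n+1}` — is produced by the drain, not in spite of it.
This file records the two elementary one-row estimates that USE the neighbours quantitatively:

* `exp_mul_le_of_drain_ge` / `le_of_drain_ge` (QUENCH): if the shell ahead stays `≥ m ≥ 0` and the feed stays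
  `≤ M²` on `[a,b)`, then with `κ = 1 + m/Λ`:
  `v(σ) ≤ v(a) e^{−κ(σ−a)} + (ΛM²/κ)(1 − e^{−κ(σ−a)})` — the shell relaxes at the FASTER rate `κ` to a level
  `≤ Λ²M²/(Λ+m)`;
* `exp_mul_ge_of_drain_le` / `ge_of_drain_le` (SUSTAIN): if the shell ahead stays `≤ Z` and the feed stays `≥ q ≥ 0`,
  then with `κ' = 1 + Z/Λ`: `v(σ) ≥ v(a) e^{−κ'(σ−a)} + (Λq/κ')(1 − e^{−κ'(σ−a)})`;
* `quench_shell` / `sustain_shell`: the same for shell `n` of a half-line solution `W` of the lattice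
  (`W_n' = −W_n + ΛW_{n−1}² − Λ⁻¹W_nW_{n+1}` on `σ > A₀`, `W ≥ 0` on `σ ≥ A`), with the neighbours `W_{n±1}`
  in the roles of `u`, `z`.

Together: while `m ≤ W_{n+1} ≤ Z` and `q ≤ W_{n−1}² ≤ M²` on a log-time window, `W_n` is driven into the band
`[Λq/(1+Z/Λ), ΛM²/(1+m/Λ)]` at rate `≥ 1 + m/Λ` — the one-row form of the K41 balance that any invariant-region
or modulation proof of (QT) has to iterate along the wake (census CENSUS-21808-leafhand4-g17.md §3).

HONEST FRAMING: elementary real analysis (weighted monotonicity); (D)/(QT) themselves are NOT proved here; rung 0.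
-/

noncomputable section

set_option linter.dupNamespace false

namespace Summit.NavierStokesRegularity.NavierStokesRegularity.Theorems

namespace WakeRatchetDyadicPostFiring

open Set Filter Topology

variable {Λ : ℝ} {W : ℤ → ℝ → ℝ} {A₀ A : ℝ}

/-! ## The weight `e^{κσ}` -/

/-- Derivative of the weight `σ ↦ e^{κσ}`. [folklore] -/
theorem hasDerivAt_exp_weight (κ σ : ℝ) :
    HasDerivAt (fun y : ℝ => Real.exp (κ * y)) (κ * Real.exp (κ * σ)) σ := by
  have h := ((hasDerivAt_id' σ).const_mul κ).exp
  refine h.congr_deriv ?_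
  ring

/-- Continuity of the weight `σ ↦ e^{κσ}`. [folklore] -/
theorem continuous_exp_weight (κ : ℝ) : Continuous fun y : ℝ => Real.exp (κ * y) :=
  Real.continuous_exp.comp (continuous_const.mul continuous_id)

/-- `e^{κa} = e^{−κ(σ−a)} · e^{κσ}`. [folklore] -/
theorem exp_weight_eq (κ a σ : ℝ) :
    Real.exp (κ * a) = Real.exp (-(κ * (σ - a))) * Real.exp (κ * σ) := by
  rw [← Real.exp_add]
  congr 1
  ring

/-! ## QUENCH: a shell ahead of size `≥ m` damps at rate `1 + m/Λ` -/

/-- **Quenching by the shell ahead (weighted form).**  If `v' = −v + Λu² − Λ⁻¹vz` on `[a,b)` with `v ≥ 0` on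
`[a,b]`, `v` continuous on `[a,b]`, the drain obeys `z ≥ m ≥ 0` and the feed `u² ≤ M²` on `[a,b)`, then with
`κ = 1 + Λ⁻¹m`:  `e^{κσ} v(σ) ≤ e^{κa} v(a) + (ΛM²/κ)(e^{κσ} − e^{κa})` for all `σ ∈ [a,b]`
(`g(σ) = e^{κσ}v(σ) − (ΛM²/κ)e^{κσ}` is non-increasing: `g' = e^{κσ}[Λ⁻¹v(m − z) + Λ(u² − M²)] ≤ 0`).
[cite: Tao2016AveragedNS, §1.2 (dyadic model), §4 Lemma 4.1 (4.8) in the self-similar variables of §6.4; elementary] -/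
theorem exp_mul_le_of_drain_ge (hΛ : 0 < Λ) {u v z : ℝ → ℝ} {a b m M : ℝ} (hm : 0 ≤ m)
    (hv : ∀ σ ∈ Ico a b, HasDerivAt v (-(v σ) + Λ * u σ ^ 2 - Λ⁻¹ * v σ * z σ) σ)
    (hvc : ContinuousOn v (Icc a b)) (hv0 : ∀ σ ∈ Icc a b, 0 ≤ v σ)
    (hz : ∀ σ ∈ Ico a b, m ≤ z σ) (hu : ∀ σ ∈ Ico a b, u σ ^ 2 ≤ M ^ 2) :
    ∀ σ ∈ Icc a b, Real.exp ((1 + Λ⁻¹ * m) * σ) * v σ ≤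
      Real.exp ((1 + Λ⁻¹ * m) * a) * v a
        + Λ * M ^ 2 / (1 + Λ⁻¹ * m) * (Real.exp ((1 + Λ⁻¹ * m) * σ) - Real.exp ((1 + Λ⁻¹ * m) * a)) := by
  set κ : ℝ := 1 + Λ⁻¹ * m with hκ
  have hΛi : 0 < Λ⁻¹ := inv_pos.2 hΛ
  have hκ0 : 0 < κ := by rw [hκ]; positivity
  set C : ℝ := Λ * M ^ 2 / κ with hC
  have hCκ : C * κ = Λ * M ^ 2 := div_mul_cancel₀ _ hκ0.ne'
  -- `g σ = e^{κσ} v σ − C e^{κσ}` is antitone on `[a,b]`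
  set g : ℝ → ℝ := fun σ => Real.exp (κ * σ) * v σ - C * Real.exp (κ * σ) with hg
  have hgc : ContinuousOn g (Icc a b) :=
    ((continuous_exp_weight κ).continuousOn.mul hvc).sub
      (continuousOn_const.mul (continuous_exp_weight κ).continuousOn)
  have hderiv : ∀ σ ∈ interior (Icc a b), HasDerivWithinAt g
      (Real.exp (κ * σ) * (κ * v σ + (-(v σ) + Λ * u σ ^ 2 - Λ⁻¹ * v σ * z σ) - C * κ))
        (interior (Icc a b)) σ := by
    intro σ hσ
    rw [interior_Icc] at hσ
    have hσ' : σ ∈ Ico a b := ⟨hσ.1.le, hσ.2⟩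
    have h1 := (hasDerivAt_exp_weight κ σ).mul (hv σ hσ')
    have h2 := (hasDerivAt_exp_weight κ σ).const_mul C
    have h3 := h1.sub h2
    refine (h3.congr_deriv ?_).hasDerivWithinAt
    ring
  have hnonpos : ∀ σ ∈ interior (Icc a b),
      Real.exp (κ * σ) * (κ * v σ + (-(v σ) + Λ * u σ ^ 2 - Λ⁻¹ * v σ * z σ) - C * κ) ≤ 0 := by
    intro σ hσ
    rw [interior_Icc] at hσ
    have hσ' : σ ∈ Ico a b := ⟨hσ.1.le, hσ.2⟩
    have hσ'' : σ ∈ Icc a b := ⟨hσ.1.le, hσ.2.le⟩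
    have hvσ : 0 ≤ v σ := hv0 σ hσ''
    have h1 : Λ⁻¹ * v σ * (m - z σ) ≤ 0 :=
      mul_nonpos_of_nonneg_of_nonpos (mul_nonneg hΛi.le hvσ) (by linarith [hz σ hσ'])
    have h2 : Λ * u σ ^ 2 ≤ Λ * M ^ 2 := mul_le_mul_of_nonneg_left (hu σ hσ') hΛ.le
    have hid : κ * v σ + (-(v σ) + Λ * u σ ^ 2 - Λ⁻¹ * v σ * z σ) - C * κ
        = Λ⁻¹ * v σ * (m - z σ) + (Λ * u σ ^ 2 - Λ * M ^ 2) := by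
      linear_combination (v σ) * hκ - hCκ
    have h3 : κ * v σ + (-(v σ) + Λ * u σ ^ 2 - Λ⁻¹ * v σ * z σ) - C * κ ≤ 0 := by
      rw [hid]; linarith
    exact mul_nonpos_iff.2 (Or.inl ⟨(Real.exp_pos _).le, h3⟩)
  have hanti : AntitoneOn g (Icc a b) :=
    antitoneOn_of_hasDerivWithinAt_nonpos (convex_Icc a b) hgc hderiv hnonpos
  intro σ hσ
  have hab : a ≤ b := hσ.1.trans hσ.2
  have h := hanti (left_mem_Icc.2 hab) hσ hσ.1
  simp only [hg] at h
  linarith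

/-- **Quenching by the shell ahead (pointwise form).**  Under the hypotheses of `exp_mul_le_of_drain_ge`, with
`κ = 1 + Λ⁻¹m`:  `v(σ) ≤ e^{−κ(σ−a)} v(a) + (ΛM²/κ)(1 − e^{−κ(σ−a)})` on `[a,b]` — relaxation at rate `κ` towards a
level `≤ ΛM²/κ = Λ²M²/(Λ+m)`.
[cite: Tao2016AveragedNS, §1.2, §4 Lemma 4.1 (4.8), §6.4; elementary] -/
theorem le_of_drain_ge (hΛ : 0 < Λ) {u v z : ℝ → ℝ} {a b m M : ℝ} (hm : 0 ≤ m)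
    (hv : ∀ σ ∈ Ico a b, HasDerivAt v (-(v σ) + Λ * u σ ^ 2 - Λ⁻¹ * v σ * z σ) σ)
    (hvc : ContinuousOn v (Icc a b)) (hv0 : ∀ σ ∈ Icc a b, 0 ≤ v σ)
    (hz : ∀ σ ∈ Ico a b, m ≤ z σ) (hu : ∀ σ ∈ Ico a b, u σ ^ 2 ≤ M ^ 2) :
    ∀ σ ∈ Icc a b, v σ ≤ Real.exp (-((1 + Λ⁻¹ * m) * (σ - a))) * v a
      + Λ * M ^ 2 / (1 + Λ⁻¹ * m) * (1 - Real.exp (-((1 + Λ⁻¹ * m) * (σ - a)))) := by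
  intro σ hσ
  set κ : ℝ := 1 + Λ⁻¹ * m with hκ
  have key := exp_mul_le_of_drain_ge hΛ hm hv hvc hv0 hz hu σ hσ
  rw [exp_weight_eq κ a σ] at key
  have hpos : 0 < Real.exp (κ * σ) := Real.exp_pos _
  refine le_of_mul_le_mul_left ?_ hpos
  have : Real.exp (κ * σ) * (Real.exp (-(κ * (σ - a))) * v a
      + Λ * M ^ 2 / κ * (1 - Real.exp (-(κ * (σ - a)))))
      = Real.exp (-(κ * (σ - a))) * Real.exp (κ * σ) * v a
        + Λ * M ^ 2 / κ * (Real.exp (κ * σ) - Real.exp (-(κ * (σ - a))) * Real.exp (κ * σ)) := by ring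
  rw [this]
  exact key

/-- **Quenched level.**  Under the hypotheses of `exp_mul_le_of_drain_ge`:
`v(σ) ≤ e^{−(1+Λ⁻¹m)(σ−a)} v(a) + ΛM²/(1+Λ⁻¹m)` on `[a,b]`.
[cite: Tao2016AveragedNS, §1.2, §4 Lemma 4.1 (4.8), §6.4; elementary] -/
theorem le_level_of_drain_ge (hΛ : 0 < Λ) {u v z : ℝ → ℝ} {a b m M : ℝ} (hm : 0 ≤ m)
    (hv : ∀ σ ∈ Ico a b, HasDerivAt v (-(v σ) + Λ * u σ ^ 2 - Λ⁻¹ * v σ * z σ) σ)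
    (hvc : ContinuousOn v (Icc a b)) (hv0 : ∀ σ ∈ Icc a b, 0 ≤ v σ)
    (hz : ∀ σ ∈ Ico a b, m ≤ z σ) (hu : ∀ σ ∈ Ico a b, u σ ^ 2 ≤ M ^ 2) :
    ∀ σ ∈ Icc a b, v σ ≤ Real.exp (-((1 + Λ⁻¹ * m) * (σ - a))) * v a + Λ * M ^ 2 / (1 + Λ⁻¹ * m) := by
  intro σ hσ
  have h := le_of_drain_ge hΛ hm hv hvc hv0 hz hu σ hσ
  have hΛi : 0 < Λ⁻¹ := inv_pos.2 hΛ
  have hC : 0 ≤ Λ * M ^ 2 / (1 + Λ⁻¹ * m) := by positivity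
  have hq : 0 ≤ Real.exp (-((1 + Λ⁻¹ * m) * (σ - a))) := (Real.exp_pos _).le
  nlinarith

/-! ## SUSTAIN: a shell ahead of size `≤ Z` and a feed `≥ q` hold the shell up -/

/-- **Sustaining by the shell behind (weighted form).**  If `v' = −v + Λu² − Λ⁻¹vz` on `[a,b)` with `v ≥ 0` on
`[a,b]`, `v` continuous on `[a,b]`, the drain obeys `z ≤ Z` and the feed `q ≤ u²` on `[a,b)`, then with
`κ' = 1 + Λ⁻¹Z`:  `e^{κ'σ} v(σ) ≥ e^{κ'a} v(a) + (Λq/κ')(e^{κ'σ} − e^{κ'a})` for all `σ ∈ [a,b]` (`0 ≤ Z`)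
(`g(σ) = e^{κ'σ}v(σ) − (Λq/κ')e^{κ'σ}` is non-decreasing: `g' = e^{κ'σ}[Λ⁻¹v(Z − z) + Λ(u² − q)] ≥ 0`).
[cite: Tao2016AveragedNS, §1.2 (dyadic model), §4 Lemma 4.1 (4.8) in the self-similar variables of §6.4; elementary] -/
theorem exp_mul_ge_of_drain_le (hΛ : 0 < Λ) {u v z : ℝ → ℝ} {a b Z q : ℝ} (hZ : 0 ≤ Z)
    (hv : ∀ σ ∈ Ico a b, HasDerivAt v (-(v σ) + Λ * u σ ^ 2 - Λ⁻¹ * v σ * z σ) σ)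
    (hvc : ContinuousOn v (Icc a b)) (hv0 : ∀ σ ∈ Icc a b, 0 ≤ v σ)
    (hz : ∀ σ ∈ Ico a b, z σ ≤ Z) (hu : ∀ σ ∈ Ico a b, q ≤ u σ ^ 2) :
    ∀ σ ∈ Icc a b, Real.exp ((1 + Λ⁻¹ * Z) * a) * v a
        + Λ * q / (1 + Λ⁻¹ * Z) * (Real.exp ((1 + Λ⁻¹ * Z) * σ) - Real.exp ((1 + Λ⁻¹ * Z) * a))
      ≤ Real.exp ((1 + Λ⁻¹ * Z) * σ) * v σ := by
  set κ : ℝ := 1 + Λ⁻¹ * Z with hκ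
  have hΛi : 0 < Λ⁻¹ := inv_pos.2 hΛ
  have hκ0 : 0 < κ := by rw [hκ]; positivity
  set C : ℝ := Λ * q / κ with hC
  have hCκ : C * κ = Λ * q := div_mul_cancel₀ _ hκ0.ne'
  set g : ℝ → ℝ := fun σ => Real.exp (κ * σ) * v σ - C * Real.exp (κ * σ) with hg
  have hgc : ContinuousOn g (Icc a b) :=
    ((continuous_exp_weight κ).continuousOn.mul hvc).sub
      (continuousOn_const.mul (continuous_exp_weight κ).continuousOn)
  have hderiv : ∀ σ ∈ interior (Icc a b), HasDerivWithinAt g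
      (Real.exp (κ * σ) * (κ * v σ + (-(v σ) + Λ * u σ ^ 2 - Λ⁻¹ * v σ * z σ) - C * κ))
        (interior (Icc a b)) σ := by
    intro σ hσ
    rw [interior_Icc] at hσ
    have hσ' : σ ∈ Ico a b := ⟨hσ.1.le, hσ.2⟩
    have h1 := (hasDerivAt_exp_weight κ σ).mul (hv σ hσ')
    have h2 := (hasDerivAt_exp_weight κ σ).const_mul C
    have h3 := h1.sub h2
    refine (h3.congr_deriv ?_).hasDerivWithinAt
    ring
  have hnonneg : ∀ σ ∈ interior (Icc a b),
      0 ≤ Real.exp (κ * σ) * (κ * v σ + (-(v σ) + Λ * u σ ^ 2 - Λ⁻¹ * v σ * z σ) - C * κ) := by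
    intro σ hσ
    rw [interior_Icc] at hσ
    have hσ' : σ ∈ Ico a b := ⟨hσ.1.le, hσ.2⟩
    have hσ'' : σ ∈ Icc a b := ⟨hσ.1.le, hσ.2.le⟩
    have hvσ : 0 ≤ v σ := hv0 σ hσ''
    have h1 : 0 ≤ Λ⁻¹ * v σ * (Z - z σ) :=
      mul_nonneg (mul_nonneg hΛi.le hvσ) (by linarith [hz σ hσ'])
    have h2 : Λ * q ≤ Λ * u σ ^ 2 := mul_le_mul_of_nonneg_left (hu σ hσ') hΛ.le
    have hid : κ * v σ + (-(v σ) + Λ * u σ ^ 2 - Λ⁻¹ * v σ * z σ) - C * κ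
        = Λ⁻¹ * v σ * (Z - z σ) + (Λ * u σ ^ 2 - Λ * q) := by
      linear_combination (v σ) * hκ - hCκ
    have h3 : 0 ≤ κ * v σ + (-(v σ) + Λ * u σ ^ 2 - Λ⁻¹ * v σ * z σ) - C * κ := by
      rw [hid]; linarith
    exact mul_nonneg (Real.exp_pos _).le h3
  have hmono : MonotoneOn g (Icc a b) :=
    monotoneOn_of_hasDerivWithinAt_nonneg (convex_Icc a b) hgc hderiv hnonneg
  intro σ hσ
  have hab : a ≤ b := hσ.1.trans hσ.2
  have h := hmono (left_mem_Icc.2 hab) hσ hσ.1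
  simp only [hg] at h
  linarith

/-- **Sustaining (pointwise form).**  Under the hypotheses of `exp_mul_ge_of_drain_le`, with `κ' = 1 + Λ⁻¹Z`:
`v(σ) ≥ e^{−κ'(σ−a)} v(a) + (Λq/κ')(1 − e^{−κ'(σ−a)})` on `[a,b]`; in particular the shell is held above
`(Λq/κ')(1 − e^{−κ'(σ−a)})`, which tends to the level `Λ²q/(Λ+Z)`.
[cite: Tao2016AveragedNS, §1.2, §4 Lemma 4.1 (4.8), §6.4; elementary] -/
theorem ge_of_drain_le (hΛ : 0 < Λ) {u v z : ℝ → ℝ} {a b Z q : ℝ} (hZ : 0 ≤ Z)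
    (hv : ∀ σ ∈ Ico a b, HasDerivAt v (-(v σ) + Λ * u σ ^ 2 - Λ⁻¹ * v σ * z σ) σ)
    (hvc : ContinuousOn v (Icc a b)) (hv0 : ∀ σ ∈ Icc a b, 0 ≤ v σ)
    (hz : ∀ σ ∈ Ico a b, z σ ≤ Z) (hu : ∀ σ ∈ Ico a b, q ≤ u σ ^ 2) :
    ∀ σ ∈ Icc a b, Real.exp (-((1 + Λ⁻¹ * Z) * (σ - a))) * v a
      + Λ * q / (1 + Λ⁻¹ * Z) * (1 - Real.exp (-((1 + Λ⁻¹ * Z) * (σ - a)))) ≤ v σ := by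
  intro σ hσ
  set κ : ℝ := 1 + Λ⁻¹ * Z with hκ
  have key := exp_mul_ge_of_drain_le hΛ hZ hv hvc hv0 hz hu σ hσ
  rw [exp_weight_eq κ a σ] at key
  have hpos : 0 < Real.exp (κ * σ) := Real.exp_pos _
  refine le_of_mul_le_mul_left ?_ hpos
  have : Real.exp (κ * σ) * (Real.exp (-(κ * (σ - a))) * v a
      + Λ * q / κ * (1 - Real.exp (-(κ * (σ - a)))))
      = Real.exp (-(κ * (σ - a))) * Real.exp (κ * σ) * v a
        + Λ * q / κ * (Real.exp (κ * σ) - Real.exp (-(κ * (σ - a))) * Real.exp (κ * σ)) := by ring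
  rw [this]
  exact key

/-! ## The lattice forms: shell `n` quenched / sustained by shells `n+1`, `n−1` -/

/-- **QUENCH on the lattice.**  For a half-line solution of the renormalised lattice (law on `σ > A₀`, `W ≥ 0` on
`σ ≥ A > A₀`): if on the window `[σ₁, σ₂]` (`A ≤ σ₁`) the shell ahead obeys `W_{n+1} ≥ m ≥ 0` and the shell behind
`W_{n−1} ≤ M`, then `W_n(σ₂) ≤ e^{−(1+Λ⁻¹m)(σ₂−σ₁)} W_n(σ₁) + ΛM²/(1+Λ⁻¹m)`.
[cite: Tao2016AveragedNS, §1.2, §4 Lemma 4.1 (4.8), §6.4; elementary] -/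
theorem quench_shell (hΛ : 0 < Λ) (hA : A₀ < A)
    (hlaw : ∀ (n : ℤ) (σ : ℝ), A₀ < σ → HasDerivAt (W n)
      (-(W n σ) + Λ * W (n - 1) σ ^ 2 - Λ⁻¹ * W n σ * W (n + 1) σ) σ)
    (hnn : ∀ (n : ℤ) (σ : ℝ), A ≤ σ → 0 ≤ W n σ)
    (n : ℤ) {σ₁ σ₂ m M : ℝ} (hσ₁ : A ≤ σ₁) (h12 : σ₁ ≤ σ₂) (hm : 0 ≤ m)
    (hahead : ∀ σ ∈ Icc σ₁ σ₂, m ≤ W (n + 1) σ) (hbehind : ∀ σ ∈ Icc σ₁ σ₂, W (n - 1) σ ≤ M) :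
    W n σ₂ ≤ Real.exp (-((1 + Λ⁻¹ * m) * (σ₂ - σ₁))) * W n σ₁ + Λ * M ^ 2 / (1 + Λ⁻¹ * m) := by
  have hIco : ∀ σ ∈ Ico σ₁ σ₂, σ ∈ Icc σ₁ σ₂ := fun σ hσ => ⟨hσ.1, hσ.2.le⟩
  refine le_level_of_drain_ge (u := W (n - 1)) (v := W n) (z := W (n + 1)) (a := σ₁) (b := σ₂) hΛ hm
    (fun σ hσ => hlaw n σ (hA.trans_le (hσ₁.trans hσ.1)))
    (continuousOn_Icc hlaw n (hA.trans_le hσ₁))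
    (fun σ hσ => hnn n σ (hσ₁.trans hσ.1))
    (fun σ hσ => hahead σ (hIco σ hσ))
    (fun σ hσ => ?_) σ₂ (right_mem_Icc.2 h12)
  have h0 : 0 ≤ W (n - 1) σ := hnn _ σ (hσ₁.trans hσ.1)
  have h1 : W (n - 1) σ ≤ M := hbehind σ (hIco σ hσ)
  exact pow_le_pow_left₀ h0 h1 2

/-- **SUSTAIN on the lattice.**  For a half-line solution of the renormalised lattice (law on `σ > A₀`, `W ≥ 0` on
`σ ≥ A > A₀`): if on the window `[σ₁, σ₂]` (`A ≤ σ₁`) the shell ahead obeys `W_{n+1} ≤ Z` (`0 ≤ Z`) and the shell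
behind `W_{n−1} ≥ μ ≥ 0`, then `W_n(σ₂) ≥ e^{−(1+Λ⁻¹Z)(σ₂−σ₁)} W_n(σ₁) + (Λμ²/(1+Λ⁻¹Z))(1 − e^{−(1+Λ⁻¹Z)(σ₂−σ₁)})`.
[cite: Tao2016AveragedNS, §1.2, §4 Lemma 4.1 (4.8), §6.4; elementary] -/
theorem sustain_shell (hΛ : 0 < Λ) (hA : A₀ < A)
    (hlaw : ∀ (n : ℤ) (σ : ℝ), A₀ < σ → HasDerivAt (W n)
      (-(W n σ) + Λ * W (n - 1) σ ^ 2 - Λ⁻¹ * W n σ * W (n + 1) σ) σ)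
    (hnn : ∀ (n : ℤ) (σ : ℝ), A ≤ σ → 0 ≤ W n σ)
    (n : ℤ) {σ₁ σ₂ Z μ : ℝ} (hσ₁ : A ≤ σ₁) (h12 : σ₁ ≤ σ₂) (hZ : 0 ≤ Z) (hμ : 0 ≤ μ)
    (hahead : ∀ σ ∈ Icc σ₁ σ₂, W (n + 1) σ ≤ Z) (hbehind : ∀ σ ∈ Icc σ₁ σ₂, μ ≤ W (n - 1) σ) :
    Real.exp (-((1 + Λ⁻¹ * Z) * (σ₂ - σ₁))) * W n σ₁
      + Λ * μ ^ 2 / (1 + Λ⁻¹ * Z) * (1 - Real.exp (-((1 + Λ⁻¹ * Z) * (σ₂ - σ₁)))) ≤ W n σ₂ := by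
  have hIco : ∀ σ ∈ Ico σ₁ σ₂, σ ∈ Icc σ₁ σ₂ := fun σ hσ => ⟨hσ.1, hσ.2.le⟩
  refine ge_of_drain_le (u := W (n - 1)) (v := W n) (z := W (n + 1)) (a := σ₁) (b := σ₂) hΛ hZ
    (fun σ hσ => hlaw n σ (hA.trans_le (hσ₁.trans hσ.1)))
    (continuousOn_Icc hlaw n (hA.trans_le hσ₁))
    (fun σ hσ => hnn n σ (hσ₁.trans hσ.1))
    (fun σ hσ => hahead σ (hIco σ hσ))
    (fun σ hσ => ?_) σ₂ (right_mem_Icc.2 h12)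
  exact pow_le_pow_left₀ hμ (hbehind σ (hIco σ hσ)) 2

end WakeRatchetDyadicPostFiring

end Summit.NavierStokesRegularity.NavierStokesRegularity.Theorems

end
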